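import Literature.NumberTheory.Automorphic.TateLocalZetaShells          -- ★ `normAbs`, `primePowBall`, `addHaar_smul_set`, `map_mul_left_addHaar` (Tate's `d(ax) = ‖a‖dx`)
import Literature.MeasureTheory.Group.LocalFieldLinearJacobian            -- ★ Haar characters: `map_eq_addEquivAddHaarChar_inv_smul`, `…_eq_of_semiconj`, `…_eq_of_conj_involutive`, `…_eq_one_of_involutive`
import Literature.NumberTheory.Automorphic.AddCharConductorExponent              -- ★ `normAbs_neg`
import Mathlib.MeasureTheory.Measure.Prod
import HarnessLib

/-!
# R90 · S6 «Ch. 14.1–14.5 stable TF» — CARD TJ1, FILE A: HAAR MODULI OF THE σ-SEMILINEAR GRADED PIECES OF THE ε-TWISTED UNIPOTENT JACOBIAN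
# (`Theorems/R90S6SemilinearHaarModuli.lean`; row E1.4.4.2.1; consumed by FILE B `Theorems/R90S6TwistedUnipotentJacobian.lean`)

Cell `hodgecm-mathlib`, crux H413 (`stmt-HodgeConjecture-24833`), route of record `HCCMUnconditional`; programme R90-TF (brief
`director/R90-BRIEF.v2.md`), section S6 (base `R90-C14`), seat R90-C14-p06 (g2); S6 dealer R90-C14-plan (g2) CARD TJ1 2026-09-05T02:01:52Z
(«§1 PURE σ-SEMILINEAR ALGEBRA … the `(E₁₂ ⊕ E₂₃)` and `E₁₃` graded pieces of `1 − Ad(δ)∘Θ_σ` on `Lie Ñ`»).  Lane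
`--kind proof --supports stmt-HodgeConjecture-24833 --as helper`; THEOREMS ONLY (no definition ∕ instance ∕ notation ∕ named fact ∕ `sorry`).

THE MATHEMATICS [WeilBNT1967, Ch. I §2; Rogawski1990, §4.10 proof of Prop. 4.10.2 p. 59].  `K` a non-archimedean local field (`K = E_w`),
`σ : K →+* K` a CONTINUOUS INVOLUTION (`σσ = id`; the conjugation of `E_w ∕ F_v`), `‖·‖ = normAbs K` the Haar module, `μ` any additive Haar
measure of `K`.  The ε-twisted commutator `ψ_δ` of the upper unitriangular group of `GL₃(K)` at `δ = diag(d₀,d₁,d₂)` is, in the coordinates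
`(x, y, z)` (FILE B §1), the map `ψ̃(x,y,z) = ((px + σy, σx + qy), cz + σz + p·xσx)` (`p = d₁∕d₀`, `q = d₂∕d₁`, `c = d₂∕d₀`), i.e. a
Haar-preserving shear glued to the two ADDITIVE (σ-semilinear, NOT `K`-linear) graded pieces
  `L₁(x,y) = (px + σy, σx + qy)` on `K × K`   and   `L₂ z = cz + σz` on `K`.
This file computes their Haar modules WITHOUT naming the fixed field `F = K^σ`:
* §1 **`map_addHaar_semilinearLine`**: `μ.map L₂ = (√‖1 − cσ(c)‖)⁻¹ • μ` for `cσ(c) ≠ 1` — `L₂ = σ ∘ (1 + S)` with `S z = σ(c)σ(z)`,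
  `S² = cσ(c)·id`, `(1 + S)(1 − S) = (1 − cσc)·id` (module `‖1 − cσc‖`), and `1 + S`, `1 − S` are conjugate under multiplication by a skew
  element `λ = x − σx ≠ 0`, so `mod(1 + S)² = ‖1 − cσc‖` (Haar characters ★ `LocalFieldLinearJacobian`; `σ` has character `1`).  This is the
  `F`-determinant `det_F(1 − S_c) = 1 − N_{K∕F}(c)` of the card read in `K` (`|u|_F = √‖u‖_K` on `K^σ`).
  **`normAbs_map_of_involution`**: `‖σx‖ = ‖x‖`.
* §1 **`map_addHaar_prod_semilinearPlane`**: `(μ ⊗ μ).map L₁ = ‖qσ(p) − 1‖⁻¹ • (μ ⊗ μ)` for `p ≠ 0`, `qσ(p) ≠ 1` — `L₁ = shear ∘ diag(p, q − (σp)⁻¹) ∘ shear`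
  (Mathlib `MeasurePreserving.skew_product`, ★ `map_mul_left_addHaar`).  This is `det_F(1 − T_{a,b}) = N_{K∕F}(1 − aσ(b))` read in `K`.
* §2 **`map_prod_prod_twistedCoord`**: `((μ ⊗ μ) ⊗ μ).map ψ̃ = (‖qσp − 1‖⁻¹ · (√‖1 − cσc‖)⁻¹) • ((μ ⊗ μ) ⊗ μ)` (`ψ̃ = (L₁ × id) ∘ shear ∘ (id × L₂)`).
* §3 **`twistedJacobian_eq_inv_normAbs_norm`**: the same scalar read at the NORM `γ = N(δ) = diag(d₀∕σd₂, d₁∕σd₁, d₂∕σd₀)`: with `a = γ₀⁻¹γ₁`,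
  `b = γ₀⁻¹γ₂`, `‖qσp − 1‖⁻¹·(√‖1 − cσc‖)⁻¹ = (‖a − 1‖·√‖b − 1‖)⁻¹` — the byte-shape of the `U(3)` unipotent Jacobian `J(t) = (‖a−1‖·√‖b−1‖)⁻¹`
  (★ `HeisRing.twistModule_eq_inv` ∕ `twistModule_cmLocal_eq`, `a = t₀⁻¹t₁`, `b = t₀⁻¹t₂`) at `t = N(δ)`.
Kill-checks (docstring level): split `K = F × F`, `σ = swap`: `L₂ = [[c₁,1],[1,c₂]]`, `|det| = |c₁c₂ − 1| = √‖(1 − c₁c₂, 1 − c₁c₂)‖` ✓; δ central ⇒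
`qσp = 1`, excluded ✓.

HONEST LABEL: local Haar-measure bookkeeping, count-neutral; proves no printed statement, discharges no citation.  HC_CM is proved only modulo the 7 printed
citations (2 remaining named inputs: hLiu418 = stmt-HodgeConjecture-24832, h413 = stmt-HodgeConjecture-24833) until rung 0 closes; REL ≠ ★ ≠ BUILT.

## Tree search
★ `map_mul_left_addHaar`, `addHaar_smul_set`, `primePowBall`, `addHaar_primePowBall_pos`, `measure_primePowBall_lt_top`, `regular_of_isAddHaarMeasure`
[TateLocalZetaShells]; ★ `measure_image_eq_addEquivAddHaarChar_mul`, `map_eq_addEquivAddHaarChar_inv_smul`, `addEquivAddHaarChar_eq_of_semiconj`,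
`addEquivAddHaarChar_eq_of_conj_involutive`, `addEquivAddHaarChar_eq_one_of_involutive` [LocalFieldLinearJacobian] (its private `addEquivAddHaarChar_eq_normAbs`
of ★ `FiniteEmbeddingNormAbs` is reproduced privately); ★ `HeisRing.involutionAddEquiv`, `distribHaarChar_map_eq`, `skewModulus_eq_sqrt` [UnitaryGroupBorelRingModulus,
InvolutionRingFixedDecomposition] are the RING-generic `U(3)` twins (not imported: `distribHaarChar` currency); Mathlib `MeasurePreserving.skew_product`,
`measurePreserving_swap`, `Measure.map_prod_map`, `addEquivAddHaarChar_trans`; ★ `normAbs_neg` [AddCharConductorExponent]; ★ `K2E3SplitTorusTwistModuleBound.normAbs_map_eq`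
(`‖σx‖ = ‖x‖` from the isometry HYPOTHESIS in the `Valued K ℤᵐ⁰` frame — here derived from continuity, kept private).  Dedup: `rg "semilinearLine|semilinearPlane|twistedCoord|inv_normAbs_norm"` — no hit.

## References
* [WeilBNT1967] A. Weil, *Basic Number Theory* (1967), Ch. I §2 (the module of an automorphism; Cor. 3 of Thm. 3).
* [Rogawski1990] J. D. Rogawski, *Automorphic Representations of Unitary Groups in Three Variables*, Ann. of Math. Stud. 123 (1990), §4.10 Prop. 4.10.2
  and its proof pp. 58–59.
* [Tate1950] J. Tate, *Fourier analysis in number fields and Hecke's zeta-functions* (1950), §2.2 Lemma 2.2.5 (`d(aξ) = ‖a‖ dξ`).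
-/

set_option autoImplicit false
-- the mandated namespace repeats the single-problem summit's segment (`HodgeConjecture.HodgeConjecture`)
set_option linter.dupNamespace false

noncomputable section

open MeasureTheory Measure Filter Topology TopologicalSpace
open scoped NNReal ENNReal Pointwise
open Literature.NumberTheory.Automorphic
open Literature.NumberTheory.GaloisRepresentations Literature.NumberTheory.GaloisRepresentations.IsNonarchimedeanLocalField

namespace Summit.HodgeConjecture.HodgeConjecture.R90.S6

/-! ## §1 Haar modules of the σ-semilinear graded pieces `L₂ z = cz + σz` on `K` and `L₁(x,y) = (px + σy, σx + qy)` on `K²` -/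

section Moduli

variable {K : Type*} [Field K] [ValuativeRel K] [TopologicalSpace K] [IsNonarchimedeanLocalField K]
  [MeasurableSpace K] [BorelSpace K]
  (σ : K →+* K) (hσ : ∀ x, σ (σ x) = x) (hσc : Continuous σ)

/-- The Haar character of a continuous additive automorphism acting as `y ↦ a y` is `‖a‖_K` (evaluate on `𝒪`, ★ `addHaar_smul_set`; public twin of the
private bridge of ★ `FiniteEmbeddingNormAbs`). [cite: WeilBNT1967, Ch. I §2] -/
private theorem addEquivAddHaarChar_eq_normAbs_of_apply_eq_mul (φ : K ≃ₜ+ K) {a : K} (ha0 : a ≠ 0) (hφ : ∀ y, φ y = a * y) :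
    addEquivAddHaarChar φ = normAbs K a := by
  haveI := regular_of_isAddHaarMeasure (addHaar : Measure K)
  have h1 := Literature.MeasureTheory.Group.measure_image_eq_addEquivAddHaarChar_mul (addHaar : Measure K) φ (primePowBall K 0)
  have himg : φ '' primePowBall K 0 = a • primePowBall K 0 := by
    rw [← Set.image_smul]
    exact Set.image_congr fun y _ => hφ y
  rw [himg, addHaar_smul_set addHaar ha0] at h1
  exact ENNReal.coe_inj.1 ((ENNReal.mul_left_inj (addHaar_primePowBall_pos (addHaar : Measure K) 0).ne'
    (measure_primePowBall_lt_top (addHaar : Measure K) 0).ne).1 h1).symm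

include hσ hσc in
/-- `‖σ x‖_K = ‖x‖_K` for a CONTINUOUS ring involution (`y ↦ σx·y` is `σ ∘ (y ↦ x y) ∘ σ` and `σ` has Haar character `1`).  Kept PRIVATE: the public
★ `K2E3SplitTorusTwistModuleBound.normAbs_map_eq` states the same conclusion in the `Valued K ℤᵐ⁰` frame from the isometry HYPOTHESIS `hσv`; here the
isometry is DERIVED from continuity in the bare `ValuativeRel` frame of this file, so neither implies the other by `exact`. [cite: WeilBNT1967, Ch. I §2] -/
private theorem normAbs_map_of_involution (x : K) : normAbs K (σ x) = normAbs K x := by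
  by_cases hx : x = 0
  · rw [hx, map_zero]
  have hσx : σ x ≠ 0 := fun h => hx (by rw [← hσ x, h, map_zero])
  let S : K ≃ₜ+ K :=
    { toFun := σ, invFun := σ, left_inv := hσ, right_inv := hσ, map_add' := map_add σ, continuous_toFun := hσc, continuous_invFun := hσc }
  let Mx : K ≃ₜ+ K :=
    { toFun := fun y => x * y, invFun := fun y => x⁻¹ * y, left_inv := fun y => by simp [hx],
      right_inv := fun y => by simp [hx], map_add' := fun y y' => mul_add x y y',
      continuous_toFun := continuous_const.mul continuous_id, continuous_invFun := continuous_const.mul continuous_id }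
  let Mσx : K ≃ₜ+ K :=
    { toFun := fun y => σ x * y, invFun := fun y => (σ x)⁻¹ * y, left_inv := fun y => by simp [hσx],
      right_inv := fun y => by simp [hσx], map_add' := fun y y' => mul_add (σ x) y y',
      continuous_toFun := continuous_const.mul continuous_id, continuous_invFun := continuous_const.mul continuous_id }
  have hconj : ∀ y, Mσx y = S (Mx (S y)) := fun y => by
    change σ x * y = σ (x * σ y)
    rw [map_mul, hσ]
  rw [← addEquivAddHaarChar_eq_normAbs_of_apply_eq_mul Mσx hσx (fun y => rfl), ← addEquivAddHaarChar_eq_normAbs_of_apply_eq_mul Mx hx (fun y => rfl)]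
  exact Literature.MeasureTheory.Group.addEquivAddHaarChar_eq_of_conj_involutive Mx Mσx S hσ hconj

include hσ hσc in
/-- **THE SKEW-LINE PIECE: `mod(z ↦ cz + σz) = √‖1 − c·σ(c)‖_K`**, in push-forward form: for every additive Haar measure `μ` on `K` and every `c`
with `cσ(c) ≠ 1`, `μ.map (z ↦ cz + σz) = (√‖1 − cσc‖)⁻¹ • μ`.  Proof without a subfield: `cz + σz = σ(z + σ(c)σ(z))`, `S z := σ(c)σ(z)` has
`S² = cσ(c)`, `(1 + S)(1 − S) = ` multiplication by `1 − cσ(c)` (module `‖1 − cσc‖`), and `1 + S`, `1 − S` are conjugate under multiplication by a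
skew element `λ = x − σx ≠ 0` (`hσ1`), so `mod(1 + S)² = ‖1 − cσc‖`.  (= the `F`-determinant `1 − N_{K∕F}(c)` of the dealer's `S_c` block read in `K`.)
[cite: WeilBNT1967, Ch. I §2] [cite: Rogawski1990, §4.10 p. 59] -/
theorem map_addHaar_semilinearLine (hσ1 : ∃ x, σ x ≠ x) (c : K) (hc : 1 - c * σ c ≠ 0) (μ : Measure K) [μ.IsAddHaarMeasure] :
    μ.map (fun z => c * z + σ z) = (((NNReal.sqrt (normAbs K (1 - c * σ c)))⁻¹ : ℝ≥0) : ℝ≥0∞) • μ := by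
  haveI : T2Space K := (isLocalField K).toT2Space
  haveI : SecondCountableTopology K := secondCountableTopology_localField K
  haveI : μ.Regular := regular_of_isAddHaarMeasure μ
  obtain ⟨x₀, hx₀⟩ := hσ1
  -- the skew element `λ = x₀ − σ x₀`
  set lam : K := x₀ - σ x₀ with hlam
  have hlamσ : σ lam = -lam := by rw [hlam, map_sub, hσ, neg_sub]
  have hlam0 : lam ≠ 0 := fun h => hx₀ (sub_eq_zero.1 h).symm
  -- the norm `N = cσ(c)` is `σ`-fixed
  have hNσ : σ (c * σ c) = c * σ c := by rw [map_mul, hσ, mul_comm]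
  have h1Nσ : σ (1 - c * σ c) = 1 - c * σ c := by rw [map_sub, map_one, hNσ]
  have h1Nσi : σ (1 - c * σ c)⁻¹ = (1 - c * σ c)⁻¹ := by rw [map_inv₀, h1Nσ]
  -- the five continuous additive automorphisms
  let S : K ≃ₜ+ K :=
    { toFun := σ, invFun := σ, left_inv := hσ, right_inv := hσ, map_add' := map_add σ, continuous_toFun := hσc, continuous_invFun := hσc }
  let P : K ≃ₜ+ K :=
    { toFun := fun z => z + σ c * σ z
      invFun := fun w => (1 - c * σ c)⁻¹ * (w - σ c * σ w)
      left_inv := fun z => by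
        simp only [map_add, map_mul, hσ]
        field_simp
        ring
      right_inv := fun w => by
        simp only [map_mul, h1Nσi, map_sub, hσ]
        field_simp
        ring
      map_add' := fun z z' => by simp only [map_add]; ring
      continuous_toFun := continuous_id.add (continuous_const.mul hσc)
      continuous_invFun := continuous_const.mul (continuous_id.sub (continuous_const.mul hσc)) }
  let M : K ≃ₜ+ K :=
    { toFun := fun z => z - σ c * σ z
      invFun := fun w => (1 - c * σ c)⁻¹ * (w + σ c * σ w)
      left_inv := fun z => by
        simp only [map_sub, map_mul, hσ]
        field_simp
        ring
      right_inv := fun w => by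
        simp only [map_mul, h1Nσi, map_add, hσ]
        field_simp
        ring
      map_add' := fun z z' => by simp only [map_add]; ring
      continuous_toFun := continuous_id.sub (continuous_const.mul hσc)
      continuous_invFun := continuous_const.mul (continuous_id.add (continuous_const.mul hσc)) }
  let L : K ≃ₜ+ K :=
    { toFun := fun z => lam * z, invFun := fun z => lam⁻¹ * z, left_inv := fun z => by simp [hlam0],
      right_inv := fun z => by simp [hlam0], map_add' := fun z z' => mul_add lam z z',
      continuous_toFun := continuous_const.mul continuous_id, continuous_invFun := continuous_const.mul continuous_id }
  let D : K ≃ₜ+ K :=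
    { toFun := fun z => (1 - c * σ c) * z, invFun := fun z => (1 - c * σ c)⁻¹ * z, left_inv := fun z => by simp [hc],
      right_inv := fun z => by simp [hc], map_add' := fun z z' => mul_add _ z z',
      continuous_toFun := continuous_const.mul continuous_id, continuous_invFun := continuous_const.mul continuous_id }
  -- `z ↦ cz + σz` is `σ ∘ P`
  have hfun : (fun z => c * z + σ z) = ⇑(P.trans S) := by
    funext z
    change c * z + σ z = σ (z + σ c * σ z)
    rw [map_add, map_mul, hσ, hσ, add_comm]
  -- `(1 − S) ∘ … : M ∘ P = D`, so `χ(M) χ(P) = ‖1 − cσc‖`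
  have hMP : M.trans P = D := by
    ext z
    change (z - σ c * σ z) + σ c * σ (z - σ c * σ z) = (1 - c * σ c) * z
    rw [map_sub, map_mul, hσ, hσ]
    ring
  have hχD : addEquivAddHaarChar D = normAbs K (1 - c * σ c) := addEquivAddHaarChar_eq_normAbs_of_apply_eq_mul D hc (fun z => rfl)
  have hχS : addEquivAddHaarChar S = 1 := Literature.MeasureTheory.Group.addEquivAddHaarChar_eq_one_of_involutive S hσ
  -- `P` and `M` are conjugate under `L`: `L (P z) = M (L z)`
  have hχPM : addEquivAddHaarChar P = addEquivAddHaarChar M :=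
    Literature.MeasureTheory.Group.addEquivAddHaarChar_eq_of_semiconj L P M (fun z => by
      change lam * (z + σ c * σ z) = lam * z - σ c * σ (lam * z)
      rw [map_mul, hlamσ]
      ring)
  have hχP : addEquivAddHaarChar P = NNReal.sqrt (normAbs K (1 - c * σ c)) := by
    rw [← hχD, ← hMP, addEquivAddHaarChar_trans, ← hχPM, NNReal.sqrt_mul_self]
  rw [hfun, Literature.MeasureTheory.Group.map_eq_addEquivAddHaarChar_inv_smul μ (P.trans S), addEquivAddHaarChar_trans, hχS, mul_one, hχP,
    ENNReal.smul_def]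

include hσ hσc in
/-- **THE PLANE PIECE: `mod((x,y) ↦ (px + σy, σx + qy)) = ‖q·σ(p) − 1‖_K`**, in push-forward form on `μ ⊗ μ`: the map factors as the shear
`(x,y) ↦ (x + p⁻¹σy, y)`, the diagonal `(x,y) ↦ (p x, (q − (σp)⁻¹) y)` and the shear `(u,v) ↦ (u, v + σ(p⁻¹u))`; shears preserve `μ ⊗ μ`
(Mathlib `MeasurePreserving.skew_product`), the diagonal costs `‖p‖⁻¹·‖q − 1∕σp‖⁻¹ = ‖qσp − 1‖⁻¹` (★ `map_mul_left_addHaar`, `‖σp‖ = ‖p‖`).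
(= the `F`-determinant `N_{K∕F}(1 − a·σb)` of the dealer's `T_{a,b}` block read in `K`.) [cite: WeilBNT1967, Ch. I §2] [cite: Rogawski1990, §4.10 p. 59] -/
theorem map_addHaar_prod_semilinearPlane (p q : K) (hp : p ≠ 0) (hpq : q * σ p - 1 ≠ 0) (μ : Measure K) [μ.IsAddHaarMeasure] :
    (μ.prod μ).map (fun v : K × K => (p * v.1 + σ v.2, σ v.1 + q * v.2)) = (((normAbs K (q * σ p - 1))⁻¹ : ℝ≥0) : ℝ≥0∞) • μ.prod μ := by
  haveI : T2Space K := (isLocalField K).toT2Space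
  haveI : SecondCountableTopology K := secondCountableTopology_localField K
  haveI : IsTopologicalRing K := inferInstance
  have hσp : σ p ≠ 0 := fun h => hp (by rw [← hσ p, h, map_zero])
  set r : K := q - (σ p)⁻¹ with hr
  have hr' : r = (σ p)⁻¹ * (q * σ p - 1) := by rw [hr]; field_simp
  have hr0 : r ≠ 0 := by rw [hr']; exact mul_ne_zero (inv_ne_zero hσp) hpq
  -- the three factors
  have hE₁ : MeasurePreserving (fun v : K × K => (v.1 + p⁻¹ * σ v.2, v.2)) (μ.prod μ) (μ.prod μ) := by
    have h : MeasurePreserving (fun v : K × K => (v.1, v.2 + p⁻¹ * σ v.1)) (μ.prod μ) (μ.prod μ) :=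
      (MeasurePreserving.id μ).skew_product (g := fun y x => x + p⁻¹ * σ y) (by fun_prop)
        (Eventually.of_forall fun y => map_add_right_eq_self μ _)
    have hcomp : (fun v : K × K => (v.1 + p⁻¹ * σ v.2, v.2)) = Prod.swap ∘ (fun v : K × K => (v.1, v.2 + p⁻¹ * σ v.1)) ∘ Prod.swap := by
      funext v; rfl
    rw [hcomp]
    exact (measurePreserving_swap (μ := μ) (ν := μ)).comp (h.comp (measurePreserving_swap (μ := μ) (ν := μ)))
  have hE₂ : (μ.prod μ).map (fun v : K × K => (p * v.1, r * v.2)) = (((normAbs K p⁻¹ * normAbs K r⁻¹ : ℝ≥0)) : ℝ≥0∞) • μ.prod μ := by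
    have h : (fun v : K × K => (p * v.1, r * v.2)) = Prod.map (fun x => p * x) (fun x => r * x) := rfl
    rw [h, ← Measure.map_prod_map _ _ (measurable_const_mul p) (measurable_const_mul r), map_mul_left_addHaar μ hp, map_mul_left_addHaar μ hr0,
      Measure.prod_smul_left, Measure.prod_smul_right, smul_smul, ENNReal.coe_mul]
  have hE₃ : MeasurePreserving (fun v : K × K => (v.1, v.2 + σ (p⁻¹ * v.1))) (μ.prod μ) (μ.prod μ) :=
    (MeasurePreserving.id μ).skew_product (g := fun x y => y + σ (p⁻¹ * x)) (by fun_prop)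
      (Eventually.of_forall fun x => map_add_right_eq_self μ _)
  -- the factorisation
  have hcomp : (fun v : K × K => (p * v.1 + σ v.2, σ v.1 + q * v.2)) =
      (fun v : K × K => (v.1, v.2 + σ (p⁻¹ * v.1))) ∘ (fun v : K × K => (p * v.1, r * v.2)) ∘ (fun v : K × K => (v.1 + p⁻¹ * σ v.2, v.2)) := by
    funext v
    simp only [Function.comp_apply, hr, map_mul, map_inv₀, map_add, hσ, Prod.mk.injEq]
    constructor
    · field_simp
    · field_simp
      ring
  have hm₁ : Measurable (fun v : K × K => (v.1 + p⁻¹ * σ v.2, v.2)) := by fun_prop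
  have hm₂ : Measurable (fun v : K × K => (p * v.1, r * v.2)) := by fun_prop
  have hm₃ : Measurable (fun v : K × K => (v.1, v.2 + σ (p⁻¹ * v.1))) := by fun_prop
  rw [hcomp, ← Measure.map_map hm₃ (hm₂.comp hm₁), ← Measure.map_map hm₂ hm₁, hE₁.map_eq, hE₂, Measure.map_smul, hE₃.map_eq]
  -- the scalar `‖p‖⁻¹‖r‖⁻¹ = ‖qσp − 1‖⁻¹`
  congr 2
  rw [← map_mul, ← mul_inv, hr', ← mul_assoc, map_inv₀, map_mul, map_mul, map_inv₀, normAbs_map_of_involution σ hσ hσc,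
    mul_inv_cancel₀ ((map_ne_zero _).2 hp), one_mul]

end Moduli

/-! ## §2 The twisted commutator on the coordinate space `(K × K) × K`: `ψ̃_* vol = J • vol` -/

section Coord

variable {K : Type*} [Field K] [ValuativeRel K] [TopologicalSpace K] [IsNonarchimedeanLocalField K]
  [MeasurableSpace K] [BorelSpace K]
  (σ : K →+* K) (hσ : ∀ x, σ (σ x) = x) (hσc : Continuous σ)

include hσ hσc in
/-- **`ψ̃_* vol = J • vol` on the coordinate space**, `vol = (μ ⊗ μ) ⊗ μ`, `ψ̃(x,y,z) = ((px + σy, σx + qy), cz + σz + p·xσx)`,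
`J = ‖qσp − 1‖⁻¹ · (√‖1 − cσc‖)⁻¹`: `ψ̃ = (L₁ × id) ∘ shear ∘ (id × L₂)` with the shear `(x,y,w) ↦ (x,y,w + p·xσx)` measure-preserving
(Mathlib `MeasurePreserving.skew_product`) and the two graded pieces of §2 (Mathlib `Measure.map_prod_map`).
[cite: WeilBNT1967, Ch. I §2] [cite: Rogawski1990, §4.10 p. 59] -/
theorem map_prod_prod_twistedCoord (hσ1 : ∃ x, σ x ≠ x) (p q c : K) (hp : p ≠ 0) (hpq : q * σ p - 1 ≠ 0) (hc : 1 - c * σ c ≠ 0)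
    (μ : Measure K) [μ.IsAddHaarMeasure] :
    ((μ.prod μ).prod μ).map (fun v : (K × K) × K => ((p * v.1.1 + σ v.1.2, σ v.1.1 + q * v.1.2), c * v.2 + σ v.2 + p * v.1.1 * σ v.1.1)) =
      ((((normAbs K (q * σ p - 1))⁻¹ * (NNReal.sqrt (normAbs K (1 - c * σ c)))⁻¹ : ℝ≥0)) : ℝ≥0∞) • (μ.prod μ).prod μ := by
  haveI : T2Space K := (isLocalField K).toT2Space
  haveI : SecondCountableTopology K := secondCountableTopology_localField K
  haveI : IsTopologicalRing K := inferInstance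
  -- the three factors `A = id × L₂`, `B` = the shear, `C = L₁ × id`
  have hL₂ : Measurable (fun z : K => c * z + σ z) := ((continuous_const.mul continuous_id).add hσc).measurable
  have hL₁ : Measurable (fun v : K × K => (p * v.1 + σ v.2, σ v.1 + q * v.2)) :=
    (((continuous_const.mul continuous_fst).add (hσc.comp continuous_snd)).prodMk
      ((hσc.comp continuous_fst).add (continuous_const.mul continuous_snd))).measurable
  have hA : ((μ.prod μ).prod μ).map (Prod.map id (fun z : K => c * z + σ z)) =
      ((((NNReal.sqrt (normAbs K (1 - c * σ c)))⁻¹ : ℝ≥0)) : ℝ≥0∞) • (μ.prod μ).prod μ := by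
    rw [← Measure.map_prod_map _ _ measurable_id hL₂, Measure.map_id, map_addHaar_semilinearLine σ hσ hσc hσ1 c hc μ, Measure.prod_smul_right]
  have hB : MeasurePreserving (fun v : (K × K) × K => (v.1, v.2 + p * v.1.1 * σ v.1.1)) ((μ.prod μ).prod μ) ((μ.prod μ).prod μ) := by
    refine (MeasurePreserving.id (μ.prod μ)).skew_product (g := fun w z => z + p * w.1 * σ w.1) ?_
      (Eventually.of_forall fun w => map_add_right_eq_self μ _)
    exact (continuous_snd.add ((continuous_const.mul (continuous_fst.comp continuous_fst)).mul
      (hσc.comp (continuous_fst.comp continuous_fst)))).measurable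
  have hC : ((μ.prod μ).prod μ).map (Prod.map (fun v : K × K => (p * v.1 + σ v.2, σ v.1 + q * v.2)) id) =
      ((((normAbs K (q * σ p - 1))⁻¹ : ℝ≥0)) : ℝ≥0∞) • (μ.prod μ).prod μ := by
    rw [← Measure.map_prod_map _ _ hL₁ measurable_id, Measure.map_id, map_addHaar_prod_semilinearPlane σ hσ hσc p q hp hpq μ, Measure.prod_smul_left]
  -- the factorisation `ψ̃ = C ∘ B ∘ A`
  have hcomp : (fun v : (K × K) × K => ((p * v.1.1 + σ v.1.2, σ v.1.1 + q * v.1.2), c * v.2 + σ v.2 + p * v.1.1 * σ v.1.1)) =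
      (Prod.map (fun v : K × K => (p * v.1 + σ v.2, σ v.1 + q * v.2)) id) ∘ (fun v : (K × K) × K => (v.1, v.2 + p * v.1.1 * σ v.1.1)) ∘
        (Prod.map id (fun z : K => c * z + σ z)) := by
    funext v; rfl
  have hmA : Measurable (Prod.map id (fun z : K => c * z + σ z) : (K × K) × K → (K × K) × K) := measurable_id.prodMap hL₂
  have hmC : Measurable (Prod.map (fun v : K × K => (p * v.1 + σ v.2, σ v.1 + q * v.2)) id : (K × K) × K → (K × K) × K) :=
    hL₁.prodMap measurable_id
  rw [hcomp, ← Measure.map_map hmC (hB.measurable.comp hmA), ← Measure.map_map hB.measurable hmA, hA, Measure.map_smul, hB.map_eq,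
    Measure.map_smul, hC, smul_smul, ENNReal.coe_mul]
  congr 1
  exact mul_comm _ _

end Coord

/-! ## §3 The Jacobian letters read at the norm `γ = N(δ) = diag(d₀∕σd₂, d₁∕σd₁, d₂∕σd₀)`: `J(δ) = (‖a − 1‖·√‖b − 1‖)⁻¹` -/

section Norm

variable {K : Type*} [Field K] [ValuativeRel K] [TopologicalSpace K] [IsNonarchimedeanLocalField K]
  [MeasurableSpace K] [BorelSpace K]
  (σ : K →+* K) (hσ : ∀ x, σ (σ x) = x) (hσc : Continuous σ)

include hσ hσc in
/-- **`J(δ) = (‖a − 1‖_K · √‖b − 1‖_K)⁻¹` AT THE NORM**: with `γ = N(δ) = diag(γ₀, γ₁, γ₂) = diag(d₀∕σd₂, d₁∕σd₁, d₂∕σd₀)` and the root values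
`a = γ₀⁻¹γ₁`, `b = γ₀⁻¹γ₂ = (d₂∕d₀)σ(d₂∕d₀) ∈ K^σ`: `‖d₂∕d₁·σ(d₁∕d₀) − 1‖ = ‖σ(a − 1)‖ = ‖a − 1‖` (`‖σ·‖ = ‖·‖`, §1) and
`1 − d₂∕d₀·σ(d₂∕d₀) = −(b − 1)`.  This is the BYTE-SHAPE `(‖a−1‖·√‖b−1‖)⁻¹` (`a = t₀⁻¹t₁`, `b = t₀⁻¹t₂`) of the `U(3)` unipotent Jacobian ★
`HeisRing.twistModule_eq_inv` ∕ ★ `twistModule_cmLocal_eq` at `t = N(δ)`: the ε-twisted Jacobian is `D_G` at the norm.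
[cite: Rogawski1990, §4.10 Prop. 4.10.2 proof p. 59; §4.9 (4.9.2) p. 55] -/
theorem twistedJacobian_eq_inv_normAbs_norm (d : Fin 3 → K) (hd0 : d 0 ≠ 0) (hd1 : d 1 ≠ 0) (hd2 : d 2 ≠ 0) :
    ((normAbs K (d 2 / d 1 * σ (d 1 / d 0) - 1))⁻¹ * (NNReal.sqrt (normAbs K (1 - d 2 / d 0 * σ (d 2 / d 0))))⁻¹ : ℝ≥0) =
      (normAbs K ((d 0 / σ (d 2))⁻¹ * (d 1 / σ (d 1)) - 1) * NNReal.sqrt (normAbs K ((d 0 / σ (d 2))⁻¹ * (d 2 / σ (d 0)) - 1)))⁻¹ := by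
  have t0 : σ (d 0) ≠ 0 := fun h => hd0 (by rw [← hσ (d 0), h, map_zero])
  have t1 : σ (d 1) ≠ 0 := fun h => hd1 (by rw [← hσ (d 1), h, map_zero])
  have t2 : σ (d 2) ≠ 0 := fun h => hd2 (by rw [← hσ (d 2), h, map_zero])
  have h1 : (d 0 / σ (d 2))⁻¹ * (d 1 / σ (d 1)) - 1 = σ (d 2 / d 1 * σ (d 1 / d 0) - 1) := by
    simp only [map_sub, map_one, map_mul, map_div₀, hσ]
    field_simp
  have h2 : (d 0 / σ (d 2))⁻¹ * (d 2 / σ (d 0)) - 1 = -(1 - d 2 / d 0 * σ (d 2 / d 0)) := by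
    simp only [map_div₀]
    field_simp
    ring
  rw [h1, h2, normAbs_map_of_involution σ hσ hσc, normAbs_neg, mul_inv]

end Norm

end Summit.HodgeConjecture.HodgeConjecture.R90.S6

end
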